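import Literature.Geometry.Riemannian.ChengYauGradientEstimate
import Literature.Geometry.Riemannian.LaplacianConstSmul
import Literature.Geometry.Riemannian.RiemannianDistanceScaling
import Literature.Geometry.Riemannian.CompleteManifoldCutoff
import Literature.Geometry.Lorentzian.MassCapacityHarmonic
import Literature.Geometry.Lorentzian.DalembertianCompose
import HarnessLib

/-!
# The Cheng–Yau gradient estimate under `Ric ≥ -(m-1)κ²` and `Ric ≥ 0`; Yau's Liouville theorem

By scaling (`g ↦ κ² g`: `♯`, `g⁻¹` and `|∇f|²` scale by `κ⁻²`, `Δ` by `κ⁻²`, distances by `κ`;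
`sharp_constSmul`, `gradSq_constSmul`, `laplaceBeltrami_constSmul`, `edist_constSmul`) the
estimate of `ChengYauGradientEstimate.lean` (`Ric ≥ -(m-1)`) becomes the printed form
(Cheng–Yau 1975, Thm. 6; Schoen–Yau, Ch. I, Thm. 3.1):

* `Ric ≥ -(m-1)κ²`, `κ > 0`: `sup_{B_{R/2}(p)} |∇ log u|² ≤ C(m) (κ + 1/R)²`
  (`chengYau_gradient_estimate_scaled`);
* `Ric ≥ 0`: `sup_{B_{R/2}(p)} |∇ log u|² ≤ C(m)/R²` (`chengYau_gradient_estimate_ricci_nonneg`);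
* **Yau's Liouville theorem** (S.-T. Yau, CPAM 28 (1975), Cor. of Thm. 3): a positive harmonic
  function on a connected complete Riemannian manifold with `Ric ≥ 0` is constant
  (`yau_liouville`);
* the **Harnack inequality** `log u(x) - log u(y) ≤ √C(m) (1 + 1/R) d(x, y)` on `B_{R/8}(p)`
  (`chengYau_harnack`, by integrating the gradient bound along minimal geodesics,
  `sub_le_mul_edist_of_gradSq_le`);
* the **localized form** for `u` smooth, positive and harmonic on the ball only
  (`chengYau_gradient_estimate_local`, via Gaffney's cut-offs `exists_cutoff_of_isGeodesicallyComplete`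
  and the locality of `Δ`, `dalembertian_congr_of_eventuallyEq`);
* the **oscillation form** `|∇u|² ≤ C(m)(1 + 2/R)² (osc_{B_R} u)²` on `B_{R/4}` for `u` harmonic on the ball
  (`chengYau_gradient_bound_osc`, applied to `u - inf u + ε`).

No definitions, no named facts (D-0026). Groundwork for `CheegerColding1997_sphereStability`.

## References

* S.-Y. Cheng, S.-T. Yau, Comm. Pure Appl. Math. 28 (1975) 333–354, Thm. 6. [ChengYau1975]
* S.-T. Yau, Comm. Pure Appl. Math. 28 (1975) 201–228, Thm. 3 and its Corollary.
* P. Topping, *Lectures on the Ricci flow* (2006), §1.2.3 (scaling). [Topping2006]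
-/

noncomputable section

open Bundle Set Function Filter
open scoped Manifold ContDiff Topology ENNReal NNReal Real

namespace Literature.Geometry.Riemannian

open Lorentzian Lorentzian.PseudoRiemannianMetric

/-! ### §1 `♯`, `g⁻¹` and `|∇f|²` under constant rescaling -/

section Scaling

variable {E : Type*} [NormedAddCommGroup E] [NormedSpace ℝ E] [FiniteDimensional ℝ E]
  {M : Type*} [TopologicalSpace M] [ChartedSpace E M] [IsManifold 𝓘(ℝ, E) ∞ M]
  (g : PseudoRiemannianMetric 𝓘(ℝ, E) ∞ E (TangentSpace 𝓘(ℝ, E) : M → Type _))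
  (c : ℝ) (hc : c ≠ 0)

/-- **`♯_{c g} = c⁻¹ ♯_g`** (both satisfy `(c g)(♯'α, w) = α w`; `♭_{cg}` is injective).
[cite: Topping2006, §1.2.3] -/
theorem sharp_constSmul (x : M) (α : Module.Dual ℝ (TangentSpace 𝓘(ℝ, E) x)) :
    (g.constSmul c hc).sharp x α = c⁻¹ • g.sharp x α := by
  apply (g.constSmul c hc).flat_injective x
  rw [flat_sharp]
  ext w
  rw [flat_apply, map_smul]
  show α w = c⁻¹ * (g.constSmul c hc).val x (g.sharp x α) w
  rw [constSmul_apply, val_sharp_apply, ← mul_assoc, inv_mul_cancel₀ hc, one_mul]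

/-- **`(c g)⁻¹(α, β) = c⁻¹ g⁻¹(α, β)`**. [cite: Topping2006, §1.2.3] -/
theorem innerDual_constSmul (x : M) (α β : Module.Dual ℝ (TangentSpace 𝓘(ℝ, E) x)) :
    (g.constSmul c hc).innerDual x α β = c⁻¹ * g.innerDual x α β := by
  rw [PseudoRiemannianMetric.innerDual, PseudoRiemannianMetric.innerDual, sharp_constSmul, map_smul,
    smul_eq_mul]

/-- **`|∇f|²_{c g} = c⁻¹ |∇f|²_g`**. [cite: Topping2006, §1.2.3] -/
theorem gradSq_constSmul (f : M → ℝ) (x : M) :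
    (g.constSmul c hc).gradSq f x = c⁻¹ * g.gradSq f x := by
  rw [PseudoRiemannianMetric.gradSq, PseudoRiemannianMetric.gradSq, innerDual_constSmul]

end Scaling

/-! ### §2 The scaled estimates -/

section Scaled

universe u v

variable {E : Type u} [NormedAddCommGroup E] [NormedSpace ℝ E] [FiniteDimensional ℝ E]
  [CompleteSpace E] {M : Type v} [TopologicalSpace M] [ChartedSpace E M] [IsManifold 𝓘(ℝ, E) ∞ M]
  [T2Space M]
  (g : PseudoRiemannianMetric 𝓘(ℝ, E) ∞ E (TangentSpace 𝓘(ℝ, E) : M → Type _)) [g.HasLeviCivita]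
  [CovariantDerivative.ContMDiffCovariantDerivative g.leviCivita 1]
  [CovariantDerivative.ContMDiffCovariantDerivative g.leviCivita ∞]

/-- **Cheng–Yau under `Ric ≥ -(m-1)κ²`** (the printed form, Cheng–Yau 1975, Thm. 6): with the
constant `C(m)` of `chengYau_gradient_estimate`, a `C^∞` function `u > 0` harmonic where
`d(p, ·) < R` satisfies `|∇ log u|²(x) ≤ C(m) (κ + 1/R)²` for `d(p, x) ≤ R/2`.
[cite: ChengYau1975, Thm. 6] -/
theorem chengYau_gradient_estimate_scaled (m : ℕ) : ∃ C : ℝ, 0 ≤ C ∧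
    ∀ {E : Type u} [NormedAddCommGroup E] [NormedSpace ℝ E] [FiniteDimensional ℝ E]
      [CompleteSpace E] {M : Type v} [TopologicalSpace M] [ChartedSpace E M]
      [IsManifold 𝓘(ℝ, E) ∞ M] [T2Space M] [ConnectedSpace M]
      (g : PseudoRiemannianMetric 𝓘(ℝ, E) ∞ E (TangentSpace 𝓘(ℝ, E) : M → Type _))
      [g.HasLeviCivita] [CovariantDerivative.ContMDiffCovariantDerivative g.leviCivita 1]
      [CovariantDerivative.ContMDiffCovariantDerivative g.leviCivita ∞]
      (hg : g.IsRiemannian) (_ : IsGeodesicallyComplete g.leviCivita),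
      Module.finrank ℝ E = m → ∀ {κ : ℝ}, 0 < κ →
      (∀ (x : M) (w : TangentSpace 𝓘(ℝ, E) x),
        -((m : ℝ) - 1) * κ ^ 2 * g.val x w w ≤ g.leviCivita.ricci x w w) →
      ∀ (u : M → ℝ), ContMDiff 𝓘(ℝ, E) 𝓘(ℝ, ℝ) ∞ u → (∀ x, 0 < u x) →
      ∀ (p : M) (R : ℝ), 0 < R →
      (∀ x, (g.edist hg p x).toReal < R → g.laplaceBeltrami u x = 0) →
      ∀ x, (g.edist hg p x).toReal ≤ R / 2 →
        g.gradSq (Real.log ∘ u) x ≤ C * (κ + 1 / R) ^ 2 := by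
  obtain ⟨C, hC0, hC⟩ := chengYau_gradient_estimate.{u, v} m
  refine ⟨C, hC0, ?_⟩
  intro E _ _ _ _ M _ _ _ _ _ g _ _ _ hg hc hdim κ hκ hRic u hu hu0 p R hR hharm x hx
  have hκ2 : (0 : ℝ) < κ ^ 2 := by positivity
  -- the rescaled metric `κ² g`
  set g' := g.constSmul (κ ^ 2) hκ2.ne' with hg'_def
  haveI : g'.HasLeviCivita := HasLeviCivita.constSmul (g := g) (κ ^ 2) hκ2.ne'
  have hLC : g'.leviCivita = g.leviCivita := leviCivita_constSmul (g := g) (κ ^ 2) hκ2.ne'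
  haveI i1 : CovariantDerivative.ContMDiffCovariantDerivative g'.leviCivita 1 := by
    rw [hLC]; infer_instance
  haveI i2 : CovariantDerivative.ContMDiffCovariantDerivative g'.leviCivita ∞ := by
    rw [hLC]; infer_instance
  have hg' : g'.IsRiemannian := hg.constSmul hκ2
  have hc' : IsGeodesicallyComplete g'.leviCivita := by rw [hLC]; exact hc
  have hRic' : ∀ (y : M) (w : TangentSpace 𝓘(ℝ, E) y),
      -((m : ℝ) - 1) * g'.val y w w ≤ g'.leviCivita.ricci y w w := fun y w ↦ by
    rw [hLC, hg'_def, constSmul_apply]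
    have := hRic y w
    nlinarith
  -- distances scale by `κ`
  have hd : ∀ y : M, (g'.edist hg' p y).toReal = κ * (g.edist hg p y).toReal := fun y ↦ by
    have h := edist_constSmul hg hκ2 p y
    rw [show (g.constSmul (κ ^ 2) hκ2.ne').edist (hg.constSmul hκ2) p y = g'.edist hg' p y from rfl]
      at h
    rw [h, Real.sqrt_sq hκ.le, ENNReal.toReal_mul, ENNReal.toReal_ofReal hκ.le]
  -- harmonicity and the hypotheses at scale `κ R`
  have hharm' : ∀ y, (g'.edist hg' p y).toReal < κ * R → g'.laplaceBeltrami u y = 0 := by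
    intro y hy
    rw [hd] at hy
    have hy' : (g.edist hg p y).toReal < R := lt_of_mul_lt_mul_left hy hκ.le
    rw [hg'_def, laplaceBeltrami_constSmul g (κ ^ 2) hκ2.ne' ((hu y).of_le (WithTop.coe_le_coe.2 le_top)),
      hharm y hy', mul_zero]
  have hx' : (g'.edist hg' p x).toReal ≤ κ * R / 2 := by
    rw [hd]; nlinarith
  have key := hC g' hg' hc' hdim hRic' u hu hu0 p (κ * R) (mul_pos hκ hR) hharm' x hx'
  -- back to `g`
  rw [hg'_def, gradSq_constSmul] at key
  have h1 : g.gradSq (Real.log ∘ u) x ≤ κ ^ 2 * (C * (1 + 1 / (κ * R)) ^ 2) := by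
    have h2 := mul_le_mul_of_nonneg_left key hκ2.le
    rwa [← mul_assoc, mul_inv_cancel₀ hκ2.ne', one_mul] at h2
  calc g.gradSq (Real.log ∘ u) x ≤ κ ^ 2 * (C * (1 + 1 / (κ * R)) ^ 2) := h1
    _ = C * (κ + 1 / R) ^ 2 := by field_simp

/-- **Cheng–Yau under `Ric ≥ 0`**: `|∇ log u|²(x) ≤ C(m)/R²` for `d(p, x) ≤ R/2` (apply the
scaled estimate with every `κ > 0` and let `κ → 0`). [cite: ChengYau1975, Thm. 6] -/
theorem chengYau_gradient_estimate_ricci_nonneg (m : ℕ) : ∃ C : ℝ, 0 ≤ C ∧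
    ∀ {E : Type u} [NormedAddCommGroup E] [NormedSpace ℝ E] [FiniteDimensional ℝ E]
      [CompleteSpace E] {M : Type v} [TopologicalSpace M] [ChartedSpace E M]
      [IsManifold 𝓘(ℝ, E) ∞ M] [T2Space M] [ConnectedSpace M]
      (g : PseudoRiemannianMetric 𝓘(ℝ, E) ∞ E (TangentSpace 𝓘(ℝ, E) : M → Type _))
      [g.HasLeviCivita] [CovariantDerivative.ContMDiffCovariantDerivative g.leviCivita 1]
      [CovariantDerivative.ContMDiffCovariantDerivative g.leviCivita ∞]
      (hg : g.IsRiemannian) (_ : IsGeodesicallyComplete g.leviCivita),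
      Module.finrank ℝ E = m →
      (∀ (x : M) (w : TangentSpace 𝓘(ℝ, E) x), 0 ≤ g.leviCivita.ricci x w w) →
      ∀ (u : M → ℝ), ContMDiff 𝓘(ℝ, E) 𝓘(ℝ, ℝ) ∞ u → (∀ x, 0 < u x) →
      ∀ (p : M) (R : ℝ), 0 < R →
      (∀ x, (g.edist hg p x).toReal < R → g.laplaceBeltrami u x = 0) →
      ∀ x, (g.edist hg p x).toReal ≤ R / 2 →
        g.gradSq (Real.log ∘ u) x ≤ C / R ^ 2 := by
  obtain ⟨C, hC0, hC⟩ := chengYau_gradient_estimate_scaled.{u, v} m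
  refine ⟨C, hC0, ?_⟩
  intro E _ _ _ _ M _ _ _ _ _ g _ _ _ hg hc hdim hRic u hu hu0 p R hR hharm x hx
  -- for every `κ > 0`, `Ric ≥ 0 ≥ -(m-1)κ² g`
  have hkey : ∀ κ : ℝ, 0 < κ → g.gradSq (Real.log ∘ u) x ≤ C * (κ + 1 / R) ^ 2 := by
    intro κ hκ
    refine hC g hg hc hdim hκ (fun y w ↦ ?_) u hu hu0 p R hR hharm x hx
    have h0 := hRic y w
    by_cases hw : w = 0
    · subst hw; simp
    have hvv : 0 ≤ g.val y w w := (hg y w hw).le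
    rcases Nat.eq_zero_or_pos m with hm0 | hmpos
    · exfalso
      have hE : Module.finrank ℝ E = 0 := by rw [hdim, hm0]
      haveI : Subsingleton E := Module.finrank_zero_iff.1 hE
      haveI : Subsingleton (TangentSpace 𝓘(ℝ, E) y) := inferInstanceAs (Subsingleton E)
      exact hw (Subsingleton.elim _ _)
    · have hm1' : (0 : ℝ) ≤ (m : ℝ) - 1 := by
        have : (1 : ℝ) ≤ m := by exact_mod_cast hmpos
        linarith
      have h1 : 0 ≤ ((m : ℝ) - 1) * κ ^ 2 * g.val y w w := by positivity
      linarith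
  -- let `κ → 0`
  refine le_of_forall_pos_lt_add fun ε hε ↦ ?_
  have hcont : ContinuousAt (fun κ : ℝ ↦ C * (κ + 1 / R) ^ 2) 0 := by fun_prop
  have hlim : Tendsto (fun κ : ℝ ↦ C * (κ + 1 / R) ^ 2) (𝓝[>] 0) (𝓝 (C / R ^ 2)) := by
    have h := hcont.tendsto
    have e : C * ((0 : ℝ) + 1 / R) ^ 2 = C / R ^ 2 := by rw [zero_add, div_pow, one_pow, mul_one_div]
    rw [e] at h
    exact h.mono_left nhdsWithin_le_nhds
  have hev : ∀ᶠ κ in 𝓝[>] (0 : ℝ), C * (κ + 1 / R) ^ 2 < C / R ^ 2 + ε :=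
    hlim (Iio_mem_nhds (by linarith))
  obtain ⟨κ, hκ, hκ0⟩ := (hev.and self_mem_nhdsWithin).exists
  exact (hkey κ hκ0).trans_lt hκ

/-! ### §3 Yau's Liouville theorem -/

/-- A function with `|∇f|² ≡ 0` on a connected manifold with complete Levi-Civita connection is
constant (test along minimal geodesics). [folklore] -/
theorem eq_of_gradSq_eq_zero [ConnectedSpace M] (hg : g.IsRiemannian)
    (hc : IsGeodesicallyComplete g.leviCivita) {f : M → ℝ} (hf : ContMDiff 𝓘(ℝ, E) 𝓘(ℝ, ℝ) ∞ f)
    (h0 : ∀ x, g.gradSq f x = 0) (x y : M) : f x = f y := by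
  haveI : Fact ((1 : ℕ∞ω) ≤ (∞ : ℕ∞ω)) := ⟨by exact_mod_cast le_top⟩
  -- `df = 0` everywhere
  have hdf : ∀ z, mvfderiv 𝓘(ℝ, E) f z = 0 := by
    intro z
    set α : Module.Dual ℝ (TangentSpace 𝓘(ℝ, E) z) :=
      (mvfderiv 𝓘(ℝ, E) f z : TangentSpace 𝓘(ℝ, E) z →ₗ[ℝ] ℝ) with hα
    have h1 : g.innerDual z α α = 0 := h0 z
    rw [innerDual_eq_val_sharp_sharp] at h1
    have h2 : g.sharp z α = 0 := by
      by_contra hne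
      exact (hg z _ hne).ne' h1
    ext v
    have h3 := g.val_sharp_apply z α v
    rw [h2, map_zero] at h3
    have h4 : α v = 0 := by rw [← h3]; rfl
    exact h4
  by_cases hxy : x = y
  · rw [hxy]
  obtain ⟨w, T, hw, hT, -, hxT⟩ := exists_unit_speed_expMap_eq_of_ne g hg hc hxy
  set γ : ℝ → M := fun σ ↦ expMap g.leviCivita y (σ • w) with hγ
  have hγs : ContMDiff 𝓘(ℝ, ℝ) 𝓘(ℝ, E) ∞ γ := (contMDiff_and_unit_speed_expMap_smul g hc y w hw).1
  have hderiv : ∀ σ, HasDerivAt (fun σ ↦ f (γ σ)) 0 σ := by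
    intro σ
    have h := hasDerivAt_comp_curve_mvfderiv ((hf (γ σ)).mdifferentiableAt (by simp))
      ((hγs σ).mdifferentiableAt (by simp))
    rw [hdf (γ σ)] at h
    simpa using h
  have hconst := is_const_of_deriv_eq_zero (fun σ ↦ (hderiv σ).differentiableAt)
    (fun σ ↦ (hderiv σ).deriv) 0 T
  have hγ0 : γ 0 = y := by simp only [hγ, zero_smul]; exact expMap_zero (cov := g.leviCivita) y
  have hγT : γ T = x := hxT
  have h5 : f (γ 0) = f (γ T) := hconst
  rw [hγ0, hγT] at h5
  exact h5.symm

/-- **Yau's Liouville theorem** (S.-T. Yau 1975; Cheng–Yau 1975, Thm. 6 with `R → ∞`): on a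
connected Riemannian manifold with complete Levi-Civita connection and `Ric ≥ 0`, every
positive `C^∞` harmonic function is constant. [cite: ChengYau1975, Thm. 6] -/
theorem yau_liouville [ConnectedSpace M] (hg : g.IsRiemannian) (hc : IsGeodesicallyComplete g.leviCivita)
    (hRic : ∀ (x : M) (w : TangentSpace 𝓘(ℝ, E) x), 0 ≤ g.leviCivita.ricci x w w)
    {u : M → ℝ} (hu : ContMDiff 𝓘(ℝ, E) 𝓘(ℝ, ℝ) ∞ u) (hu0 : ∀ x, 0 < u x)
    (hharm : ∀ x, g.laplaceBeltrami u x = 0) (x y : M) : u x = u y := by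
  obtain ⟨C, hC0, hC⟩ := chengYau_gradient_estimate_ricci_nonneg.{u, v} (Module.finrank ℝ E)
  have hφ : ContMDiff 𝓘(ℝ, E) 𝓘(ℝ, ℝ) ∞ (Real.log ∘ u) := fun z ↦
    ((Real.contDiffAt_log.2 (hu0 z).ne').contMDiffAt).comp z (hu z)
  -- `|∇ log u|² ≤ C/R²` for every `R`, hence `0`
  have h0 : ∀ z, g.gradSq (Real.log ∘ u) z = 0 := by
    intro z
    have hnn : 0 ≤ g.gradSq (Real.log ∘ u) z := g.innerDual_self_nonneg hg z _
    refine le_antisymm (le_of_forall_pos_lt_add fun ε hε ↦ ?_) hnn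
    -- choose `R` with `C/R² < ε`
    obtain ⟨R, hR⟩ : ∃ R : ℝ, 0 < R ∧ C / R ^ 2 < ε := by
      refine ⟨Real.sqrt (C / ε) + 1, by positivity, ?_⟩
      rw [div_lt_iff₀ (by positivity)]
      have h1 : C / ε < (Real.sqrt (C / ε) + 1) ^ 2 := by
        have h2 := Real.sq_sqrt (div_nonneg hC0 hε.le)
        nlinarith [Real.sqrt_nonneg (C / ε)]
      have h3 := (div_lt_iff₀ hε).1 h1
      linarith
    have h := hC g hg hc rfl hRic u hu hu0 z R hR.1 (fun y _ ↦ hharm y) z (by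
      rw [PseudoRiemannianMetric.edist_self, ENNReal.toReal_zero]; linarith)
    linarith
  have h := eq_of_gradSq_eq_zero g hg hc hφ h0 x y
  simp only [Function.comp] at h
  exact Real.log_injOn_pos (hu0 x) (hu0 y) h

/-! ### §4 Integration along minimal geodesics: the Harnack inequality -/

/-- **Integrating a gradient bound along a minimal geodesic**: if `|∇f|² ≤ A²` (`A ≥ 0`) at every
point within distance `r` of `p`, then for `x, y` with `d(p, x), d(p, y) ≤ ρ` and `2ρ... ` — precisely
whenever `d(p, y) + d(x, y) < r` — `f x - f y ≤ A d(x, y)` (mean value theorem along the unit-speed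
minimal geodesic from `y` to `x`, which stays in `B_r(p)`). [folklore] -/
theorem sub_le_mul_edist_of_gradSq_le [ConnectedSpace M] (hg : g.IsRiemannian)
    (hc : IsGeodesicallyComplete g.leviCivita) {f : M → ℝ} (hf : ContMDiff 𝓘(ℝ, E) 𝓘(ℝ, ℝ) ∞ f)
    (p : M) {r A : ℝ} (hA : 0 ≤ A)
    (hgrad : ∀ z, (g.edist hg p z).toReal < r → g.gradSq f z ≤ A ^ 2) {x y : M}
    (hxy : (g.edist hg p y).toReal + (g.edist hg y x).toReal < r) :
    f x - f y ≤ A * (g.edist hg y x).toReal := by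
  haveI : Fact ((1 : ℕ∞ω) ≤ (∞ : ℕ∞ω)) := ⟨by exact_mod_cast le_top⟩
  by_cases hxy0 : x = y
  · subst hxy0
    rw [sub_self]; exact mul_nonneg hA ENNReal.toReal_nonneg
  obtain ⟨w, T, hw, hT, hTx, hxT⟩ := exists_unit_speed_expMap_eq_of_ne g hg hc hxy0
  set γ : ℝ → M := fun σ ↦ expMap g.leviCivita y (σ • w) with hγ
  have hγs : ContMDiff 𝓘(ℝ, ℝ) 𝓘(ℝ, E) ∞ γ := (contMDiff_and_unit_speed_expMap_smul g hc y w hw).1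
  have hγ0 : γ 0 = y := by simp only [hγ, zero_smul]; exact expMap_zero (cov := g.leviCivita) y
  have hγT : γ T = x := hxT
  -- the derivative of `f ∘ γ` and its bound on `[0, T]`
  have hderiv : ∀ σ, HasDerivAt (fun σ ↦ f (γ σ))
      (mvfderiv 𝓘(ℝ, E) f (γ σ) (velocity 𝓘(ℝ, E) γ σ)) σ := fun σ ↦
    hasDerivAt_comp_curve_mvfderiv ((hf (γ σ)).mdifferentiableAt (by simp))
      ((hγs σ).mdifferentiableAt (by simp))
  have hbound : ∀ σ ∈ Ico (0 : ℝ) T, mvfderiv 𝓘(ℝ, E) f (γ σ) (velocity 𝓘(ℝ, E) γ σ) ≤ A := by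
    intro σ hσ
    -- `γ σ` lies in `B_r(p)`
    have hin : (g.edist hg p (γ σ)).toReal < r := by
      have h1 := (edist_expMap_smul_toReal_le_abs g hg hc y w hw σ).2
      rw [abs_of_nonneg hσ.1] at h1
      have h2 : (g.edist hg p (γ σ)).toReal ≤ (g.edist hg p y).toReal + (g.edist hg y (γ σ)).toReal := by
        have h := ENNReal.toReal_mono (ENNReal.add_ne_top.2 ⟨edist_ne_top hg p y, edist_ne_top hg y _⟩)
          (g.edist_triangle hg p y (γ σ))
        rwa [ENNReal.toReal_add (edist_ne_top hg p y) (edist_ne_top hg y _)] at h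
      have h3 : σ < (g.edist hg y x).toReal := by rw [← hTx]; exact hσ.2
      show (g.edist hg p (expMap g.leviCivita y (σ • w))).toReal < r
      linarith [h2, h1]
    have hQ := hgrad (γ σ) hin
    have hspeed : g.val (γ σ) (velocity 𝓘(ℝ, E) γ σ) (velocity 𝓘(ℝ, E) γ σ) = 1 := by
      show g.val (expMap g.leviCivita y (σ • w)) (velocity 𝓘(ℝ, E) (fun σ ↦ expMap g.leviCivita y (σ • w)) σ)
        (velocity 𝓘(ℝ, E) (fun σ ↦ expMap g.leviCivita y (σ • w)) σ) = 1
      rw [val_velocity_expMap_smul g hc y w σ, hw]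
    have hCS := abs_mvfderiv_le_sqrt_gradSq_mul_sqrt g hg f (γ σ) (velocity 𝓘(ℝ, E) γ σ)
    rw [hspeed, Real.sqrt_one, mul_one] at hCS
    have hsq : Real.sqrt (g.gradSq f (γ σ)) ≤ A := by
      rw [← Real.sqrt_sq hA]; exact Real.sqrt_le_sqrt hQ
    exact (le_abs_self _).trans (hCS.trans hsq)
  -- mean value theorem
  have hmvt := image_le_of_deriv_right_le_deriv_boundary (f := fun σ ↦ f (γ σ)) (a := 0) (b := T)
    (fun σ _ ↦ (hderiv σ).continuousAt.continuousWithinAt)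
    (fun σ _ ↦ (hderiv σ).hasDerivWithinAt)
    (B := fun σ ↦ f y + A * σ) (B' := fun _ ↦ A) (by simp [hγ0])
    (by fun_prop)
    (fun σ _ ↦ (((hasDerivAt_id σ).const_mul A).const_add (f y)).hasDerivWithinAt.congr_deriv
      (by ring))
    (fun σ hσ ↦ hbound σ hσ) (right_mem_Icc.2 hT.le)
  have hmvt' : f (γ T) ≤ f y + A * T := hmvt
  rw [hγT, hTx] at hmvt'
  linarith

/-- **The Harnack inequality from the Cheng–Yau estimate** (Cheng–Yau 1975; Schoen–Yau, Ch. I,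
Cor. 3.1): with `C(m)` of `chengYau_gradient_estimate`, under `Ric ≥ -(m-1)` a `C^∞` function
`u > 0` harmonic where `d(p, ·) < R` satisfies, for `d(p, x), d(p, y) ≤ R/8`,
`log u(x) - log u(y) ≤ √C (1 + 1/R) d(y, x)` (`≤ √C (1 + 1/R) R/4`).
[cite: ChengYau1975, Thm. 6] -/
theorem chengYau_harnack (m : ℕ) : ∃ C : ℝ, 0 ≤ C ∧
    ∀ {E : Type u} [NormedAddCommGroup E] [NormedSpace ℝ E] [FiniteDimensional ℝ E]
      [CompleteSpace E] {M : Type v} [TopologicalSpace M] [ChartedSpace E M]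
      [IsManifold 𝓘(ℝ, E) ∞ M] [T2Space M] [ConnectedSpace M]
      (g : PseudoRiemannianMetric 𝓘(ℝ, E) ∞ E (TangentSpace 𝓘(ℝ, E) : M → Type _))
      [g.HasLeviCivita] [CovariantDerivative.ContMDiffCovariantDerivative g.leviCivita 1]
      [CovariantDerivative.ContMDiffCovariantDerivative g.leviCivita ∞]
      (hg : g.IsRiemannian) (_ : IsGeodesicallyComplete g.leviCivita),
      Module.finrank ℝ E = m →
      (∀ (x : M) (w : TangentSpace 𝓘(ℝ, E) x),
        -((m : ℝ) - 1) * g.val x w w ≤ g.leviCivita.ricci x w w) →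
      ∀ (u : M → ℝ), ContMDiff 𝓘(ℝ, E) 𝓘(ℝ, ℝ) ∞ u → (∀ x, 0 < u x) →
      ∀ (p : M) (R : ℝ), 0 < R →
      (∀ x, (g.edist hg p x).toReal < R → g.laplaceBeltrami u x = 0) →
      ∀ x y, (g.edist hg p x).toReal ≤ R / 8 → (g.edist hg p y).toReal ≤ R / 8 →
        Real.log (u x) - Real.log (u y) ≤ Real.sqrt C * (1 + 1 / R) * (g.edist hg y x).toReal := by
  obtain ⟨C, hC0, hC⟩ := chengYau_gradient_estimate.{u, v} m
  refine ⟨C, hC0, ?_⟩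
  intro E _ _ _ _ M _ _ _ _ _ g _ _ _ hg hc hdim hRic u hu hu0 p R hR hharm x y hx hy
  have hφ : ContMDiff 𝓘(ℝ, E) 𝓘(ℝ, ℝ) ∞ (Real.log ∘ u) := fun z ↦
    ((Real.contDiffAt_log.2 (hu0 z).ne').contMDiffAt).comp z (hu z)
  have hA : 0 ≤ Real.sqrt C * (1 + 1 / R) := by positivity
  have hgrad : ∀ z, (g.edist hg p z).toReal < R / 2 →
      g.gradSq (Real.log ∘ u) z ≤ (Real.sqrt C * (1 + 1 / R)) ^ 2 := by
    intro z hz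
    have h := hC g hg hc hdim hRic u hu hu0 p R hR hharm z hz.le
    rwa [mul_pow, Real.sq_sqrt hC0]
  -- `d(p, y) + d(y, x) < R/2`
  have hyx : (g.edist hg y x).toReal ≤ (g.edist hg y p).toReal + (g.edist hg p x).toReal := by
    have h := ENNReal.toReal_mono (ENNReal.add_ne_top.2 ⟨edist_ne_top hg y p, edist_ne_top hg p x⟩)
      (g.edist_triangle hg y p x)
    rwa [ENNReal.toReal_add (edist_ne_top hg y p) (edist_ne_top hg p x)] at h
  rw [g.edist_comm hg y p] at hyx
  have hsum : (g.edist hg p y).toReal + (g.edist hg y x).toReal < R / 2 := by linarith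
  have h := sub_le_mul_edist_of_gradSq_le g hg hc hφ p hA hgrad hsum
  simpa [Function.comp] using h

/-! ### §5 Localization: `u` positive and harmonic on the ball only -/

/-- **Cheng–Yau for functions defined on the ball** (the printed hypotheses): with `C(m)` of
`chengYau_gradient_estimate`, on a connected second countable Riemannian `m`-manifold with
complete Levi-Civita connection and `Ric ≥ -(m-1)`, a function `u` which is `C^∞`, positive and
harmonic on the open ball `{d(p, ·) < R}` satisfies `|∇ log u|²(x) ≤ C(m)(1 + 2/R)²` for
`d(p, x) ≤ R/4` (apply the global form at scale `R/2` to the positive smooth globalisation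
`χ u + (1 - χ)`, `χ` one of Gaffney's cut-offs `exists_cutoff_of_isGeodesicallyComplete`).
[cite: ChengYau1975, Thm. 6] -/
theorem chengYau_gradient_estimate_local (m : ℕ) : ∃ C : ℝ, 0 ≤ C ∧
    ∀ {E : Type u} [NormedAddCommGroup E] [NormedSpace ℝ E] [FiniteDimensional ℝ E]
      [CompleteSpace E] {M : Type v} [TopologicalSpace M] [ChartedSpace E M]
      [IsManifold 𝓘(ℝ, E) ∞ M] [T2Space M] [SecondCountableTopology M] [ConnectedSpace M]
      (g : PseudoRiemannianMetric 𝓘(ℝ, E) ∞ E (TangentSpace 𝓘(ℝ, E) : M → Type _))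
      [g.HasLeviCivita] [CovariantDerivative.ContMDiffCovariantDerivative g.leviCivita 1]
      [CovariantDerivative.ContMDiffCovariantDerivative g.leviCivita ∞]
      (hg : g.IsRiemannian) (_ : IsGeodesicallyComplete g.leviCivita),
      Module.finrank ℝ E = m →
      (∀ (x : M) (w : TangentSpace 𝓘(ℝ, E) x),
        -((m : ℝ) - 1) * g.val x w w ≤ g.leviCivita.ricci x w w) →
      ∀ (u : M → ℝ) (p : M) (R : ℝ), 0 < R →
      (∀ x, (g.edist hg p x).toReal < R → ContMDiffAt 𝓘(ℝ, E) 𝓘(ℝ, ℝ) ∞ u x) →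
      (∀ x, (g.edist hg p x).toReal < R → 0 < u x) →
      (∀ x, (g.edist hg p x).toReal < R → g.laplaceBeltrami u x = 0) →
      ∀ x, (g.edist hg p x).toReal ≤ R / 4 →
        g.gradSq (Real.log ∘ u) x ≤ C * (1 + 2 / R) ^ 2 := by
  obtain ⟨C, hC0, hC⟩ := chengYau_gradient_estimate.{u, v} m
  obtain ⟨C₀, hcut⟩ := exists_cutoff_of_isGeodesicallyComplete.{u, u, v}
  refine ⟨C, hC0, ?_⟩
  intro E _ _ _ _ M _ _ _ _ _ _ g _ _ _ hg hc hdim hRic u p R hR hu hu0 hharm x hx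
  haveI : LocallyCompactSpace M := Manifold.locallyCompact_of_finiteDimensional 𝓘(ℝ, E)
  haveI : RegularSpace M := inferInstance
  obtain ⟨χ, hχs, -, hχ0, hχ1, hχone, hχsupp, -⟩ := hcut 𝓘(ℝ, E) M g hg hc p R hR
  -- the globalisation `ũ = χ u + (1 - χ)`
  set ut : M → ℝ := fun y ↦ χ y * u y + (1 - χ y) with hut
  have hball : ∀ y, y ∈ tsupport χ → (g.edist hg p y).toReal < R := fun y hy ↦ by
    have h := hχsupp hy
    simp only [mem_setOf_eq] at h
    exact (ENNReal.lt_ofReal_iff_toReal_lt (edist_ne_top hg p y)).1 h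
  have huts : ContMDiff 𝓘(ℝ, E) 𝓘(ℝ, ℝ) ∞ ut := by
    intro y
    by_cases hy : y ∈ tsupport χ
    · exact ((hχs y).mul (hu y (hball y hy))).add (contMDiffAt_const.sub (hχs y))
    · -- `χ ≡ 0` near `y`, so `ũ ≡ 1`
      have hev : χ =ᶠ[𝓝 y] fun _ ↦ 0 := by
        have h : (tsupport χ)ᶜ ∈ 𝓝 y := (isClosed_tsupport χ).isOpen_compl.mem_nhds hy
        filter_upwards [h] with z hz using image_eq_zero_of_notMem_tsupport hz
      have hev' : ut =ᶠ[𝓝 y] fun _ ↦ 1 := by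
        filter_upwards [hev] with z hz
        show χ z * u z + (1 - χ z) = 1
        rw [hz]; ring
      exact contMDiffAt_const.congr_of_eventuallyEq hev'
  have hut0 : ∀ y, 0 < ut y := by
    intro y
    by_cases hy : y ∈ tsupport χ
    · have h1 := hu0 y (hball y hy)
      have h2 := hχ0 y; have h3 := hχ1 y
      show 0 < χ y * u y + (1 - χ y)
      rcases h2.eq_or_lt with h | h
      · rw [← h]; norm_num
      · nlinarith
    · have : χ y = 0 := image_eq_zero_of_notMem_tsupport hy
      show 0 < χ y * u y + (1 - χ y)
      rw [this]; norm_num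
  -- `ũ = u` on the ball of radius `R/2`, where it is harmonic
  have heq : ∀ y, (g.edist hg p y).toReal < R / 2 → ut y = u y := by
    intro y hy
    have h1 : χ y = 1 := hχone y ((ENNReal.lt_ofReal_iff_toReal_lt (edist_ne_top hg p y)).2 hy)
    show χ y * u y + (1 - χ y) = u y
    rw [h1]; ring
  have hρcont : Continuous fun y ↦ (g.edist hg p y).toReal :=
    ENNReal.continuousOn_toReal.comp_continuous
      ((PseudoRiemannianMetric.continuous_edist hg).comp (Continuous.prodMk_right p))
      fun y ↦ edist_ne_top hg p y
  have heqev : ∀ y, (g.edist hg p y).toReal < R / 2 → ut =ᶠ[𝓝 y] u := by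
    intro y hy
    have h : {z | (g.edist hg p z).toReal < R / 2} ∈ 𝓝 y :=
      (isOpen_lt hρcont continuous_const).mem_nhds hy
    filter_upwards [h] with z hz using heq z hz
  have hharm' : ∀ y, (g.edist hg p y).toReal < R / 2 → g.laplaceBeltrami ut y = 0 := by
    intro y hy
    rw [laplaceBeltrami_eq_dalembertian, g.dalembertian_congr_of_eventuallyEq (heqev y hy),
      ← laplaceBeltrami_eq_dalembertian]
    exact hharm y (by linarith)
  -- the global estimate at scale `R/2`
  have key := hC g hg hc hdim hRic ut huts hut0 p (R / 2) (half_pos hR) hharm' x (by linarith)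
  -- `log ũ` and `log u` agree near `x`
  have hlog : g.gradSq (Real.log ∘ u) x = g.gradSq (Real.log ∘ ut) x := by
    have hev : Real.log ∘ u =ᶠ[𝓝 x] Real.log ∘ ut := by
      filter_upwards [heqev x (by linarith)] with z hz
      simp only [Function.comp, hz]
    simp only [PseudoRiemannianMetric.gradSq, mvfderiv_congr_of_eventuallyEq hev]
  rw [hlog]
  calc g.gradSq (Real.log ∘ ut) x ≤ C * (1 + 1 / (R / 2)) ^ 2 := key
    _ = C * (1 + 2 / R) ^ 2 := by congr 2; field_simp

/-! ### §6 The gradient bound for harmonic functions in oscillation form -/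

/-- **Interior gradient estimate for harmonic functions** (Cheng–Yau 1975, Cor. of Thm. 6;
Schoen–Yau, Ch. I, Cor. 3.2): with `C(m)` of `chengYau_gradient_estimate`, on a connected second
countable Riemannian `m`-manifold with complete Levi-Civita connection and `Ric ≥ -(m-1)`, a
function `u` which is `C^∞` and harmonic on the open ball `{d(p, ·) < R}` with
`m₀ ≤ u ≤ M₀` there satisfies `|∇u|²(x) ≤ C(m)(1 + 2/R)² (M₀ - m₀)²` for `d(p, x) ≤ R/4`
(the localized estimate applied to the positive harmonic functions `u - m₀ + ε`).
[cite: ChengYau1975, Thm. 6] -/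
theorem chengYau_gradient_bound_osc (m : ℕ) : ∃ C : ℝ, 0 ≤ C ∧
    ∀ {E : Type u} [NormedAddCommGroup E] [NormedSpace ℝ E] [FiniteDimensional ℝ E]
      [CompleteSpace E] {M : Type v} [TopologicalSpace M] [ChartedSpace E M]
      [IsManifold 𝓘(ℝ, E) ∞ M] [T2Space M] [SecondCountableTopology M] [ConnectedSpace M]
      (g : PseudoRiemannianMetric 𝓘(ℝ, E) ∞ E (TangentSpace 𝓘(ℝ, E) : M → Type _))
      [g.HasLeviCivita] [CovariantDerivative.ContMDiffCovariantDerivative g.leviCivita 1]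
      [CovariantDerivative.ContMDiffCovariantDerivative g.leviCivita ∞]
      (hg : g.IsRiemannian) (_ : IsGeodesicallyComplete g.leviCivita),
      Module.finrank ℝ E = m →
      (∀ (x : M) (w : TangentSpace 𝓘(ℝ, E) x),
        -((m : ℝ) - 1) * g.val x w w ≤ g.leviCivita.ricci x w w) →
      ∀ (u : M → ℝ) (p : M) (R : ℝ), 0 < R →
      (∀ x, (g.edist hg p x).toReal < R → ContMDiffAt 𝓘(ℝ, E) 𝓘(ℝ, ℝ) ∞ u x) →
      (∀ x, (g.edist hg p x).toReal < R → g.laplaceBeltrami u x = 0) →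
      ∀ (m₀ M₀ : ℝ), (∀ x, (g.edist hg p x).toReal < R → m₀ ≤ u x ∧ u x ≤ M₀) →
      ∀ x, (g.edist hg p x).toReal ≤ R / 4 →
        g.gradSq u x ≤ C * (1 + 2 / R) ^ 2 * (M₀ - m₀) ^ 2 := by
  obtain ⟨C, hC0, hC⟩ := chengYau_gradient_estimate_local.{u, v} m
  refine ⟨C, hC0, ?_⟩
  intro E _ _ _ _ M _ _ _ _ _ _ g _ _ _ hg hc hdim hRic u p R hR hu hharm m₀ M₀ hbd x hx
  haveI : Fact ((1 : ℕ∞ω) ≤ (∞ : ℕ∞ω)) := ⟨by exact_mod_cast le_top⟩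
  have hxR : (g.edist hg p x).toReal < R := by linarith
  -- for every `ε > 0`, the positive harmonic function `U = u - m₀ + ε`
  have key : ∀ ε : ℝ, 0 < ε → g.gradSq u x ≤ C * (1 + 2 / R) ^ 2 * (M₀ - m₀ + ε) ^ 2 := by
    intro ε hε
    set ζ : ℝ → ℝ := fun t ↦ t + (ε - m₀) with hζ
    have hζs : ContDiff ℝ ∞ ζ := contDiff_id.add contDiff_const
    have hζ' : ∀ t, deriv ζ t = 1 := fun t ↦ by
      show deriv (fun t ↦ t + (ε - m₀)) t = 1
      rw [deriv_add_const, deriv_id'']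
    have hζ'' : ∀ t, deriv (deriv ζ) t = 0 := fun t ↦ by
      have : deriv ζ = fun _ ↦ 1 := funext hζ'
      rw [this, deriv_const]
    have hUs : ∀ y, (g.edist hg p y).toReal < R → ContMDiffAt 𝓘(ℝ, E) 𝓘(ℝ, ℝ) ∞ (ζ ∘ u) y :=
      fun y hy ↦ hζs.contDiffAt.contMDiffAt.comp y (hu y hy)
    have hU0 : ∀ y, (g.edist hg p y).toReal < R → 0 < (ζ ∘ u) y := fun y hy ↦ by
      show 0 < u y + (ε - m₀)
      linarith [(hbd y hy).1]
    have hUharm : ∀ y, (g.edist hg p y).toReal < R → g.laplaceBeltrami (ζ ∘ u) y = 0 := by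
      intro y hy
      have hu2 : CMDiffAt 2 u y := (hu y hy).of_le (by norm_cast)
      rw [laplaceBeltrami_eq_dalembertian, g.dalembertian_real_comp hu2
        ((hζs.of_le (by norm_cast)).contDiffAt),
        hζ'', hζ', zero_mul, zero_add, one_mul, ← laplaceBeltrami_eq_dalembertian]
      exact hharm y hy
    have h1 := hC g hg hc hdim hRic (ζ ∘ u) p R hR hUs hU0 hUharm x hx
    -- `|∇ log U|² = |∇u|²/U²`
    have hud : MDifferentiableAt 𝓘(ℝ, E) 𝓘(ℝ, ℝ) u x := (hu x hxR).mdifferentiableAt (by simp)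
    have hUd : MDifferentiableAt 𝓘(ℝ, E) 𝓘(ℝ, ℝ) (ζ ∘ u) x := (hUs x hxR).mdifferentiableAt (by simp)
    have hUx : 0 < (ζ ∘ u) x := hU0 x hxR
    have hgU : g.gradSq (ζ ∘ u) x = g.gradSq u x := by
      rw [gradSq_comp_real_eq_deriv_sq_mul g (hζs.contDiffAt.differentiableAt (by simp)) hud, hζ',
        one_pow, one_mul]
    have hglog : g.gradSq (Real.log ∘ (ζ ∘ u)) x = ((ζ ∘ u) x)⁻¹ ^ 2 * g.gradSq u x := by
      rw [gradSq_comp_real_eq_deriv_sq_mul g (Real.differentiableAt_log hUx.ne') hUd, Real.deriv_log,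
        hgU]
    rw [hglog] at h1
    -- `|∇u|² ≤ C (1+2/R)² U² ≤ C (1+2/R)² (M₀ - m₀ + ε)²`
    have hU2 : 0 < ((ζ ∘ u) x) ^ 2 := by positivity
    have h2 : g.gradSq u x ≤ C * (1 + 2 / R) ^ 2 * ((ζ ∘ u) x) ^ 2 := by
      have h3 := mul_le_mul_of_nonneg_right h1 hU2.le
      have e : ((ζ ∘ u) x)⁻¹ ^ 2 * g.gradSq u x * ((ζ ∘ u) x) ^ 2 = g.gradSq u x := by
        field_simp
      rwa [e] at h3
    have hUle : ((ζ ∘ u) x) ^ 2 ≤ (M₀ - m₀ + ε) ^ 2 := by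
      have h4 : (ζ ∘ u) x ≤ M₀ - m₀ + ε := by
        show u x + (ε - m₀) ≤ M₀ - m₀ + ε
        linarith [(hbd x hxR).2]
      exact pow_le_pow_left₀ hUx.le h4 2
    calc g.gradSq u x ≤ C * (1 + 2 / R) ^ 2 * ((ζ ∘ u) x) ^ 2 := h2
      _ ≤ C * (1 + 2 / R) ^ 2 * (M₀ - m₀ + ε) ^ 2 := by gcongr
  -- `ε → 0`
  refine le_of_forall_pos_lt_add fun δ hδ ↦ ?_
  have hcont : ContinuousAt (fun ε : ℝ ↦ C * (1 + 2 / R) ^ 2 * (M₀ - m₀ + ε) ^ 2) 0 := by fun_prop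
  have hlim : Tendsto (fun ε : ℝ ↦ C * (1 + 2 / R) ^ 2 * (M₀ - m₀ + ε) ^ 2) (𝓝[>] 0)
      (𝓝 (C * (1 + 2 / R) ^ 2 * (M₀ - m₀) ^ 2)) := by
    have h := hcont.tendsto
    rw [add_zero] at h
    exact h.mono_left nhdsWithin_le_nhds
  have hev : ∀ᶠ ε in 𝓝[>] (0 : ℝ), C * (1 + 2 / R) ^ 2 * (M₀ - m₀ + ε) ^ 2 <
      C * (1 + 2 / R) ^ 2 * (M₀ - m₀) ^ 2 + δ := hlim (Iio_mem_nhds (by linarith))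
  obtain ⟨ε, hε, hε0⟩ := (hev.and self_mem_nhdsWithin).exists
  exact (key ε hε0).trans_lt hε

end Scaled

end Literature.Geometry.Riemannian

end
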